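import Summits.HubbardSuperconductivity.HubbardSuperconductivity.Theorems.BalabanIRBirGroundStateAverageLRO
import Summits.HubbardSuperconductivity.HubbardSuperconductivity.Theorems.BalabanIRBirEveryGroundStateSocket

/-!
# Route BalabanIR — crux `BirGroundStateAverageLRO` (item `stmt-HubbardSuperconductivity-2079`):
# Baire-category uniformisation of per-coupling floors on a window

The crux `BirGroundStateAverageLRO` asks for ONE constant `c > 0` serving EVERY coupling `U` of an open
window `(U₁, U₂)` (the quantifier order is `∃ c, ∀ U ∈ window, ∃ L₀, ∀ L ≥ L₀`).  Any mechanism — in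
this route or in a neighbouring one (`WeakCouplingBCS`, per-coupling statements
`HasDWavePairFieldLROAt U δ`) — that delivers the ground-state pair-order floor coupling by coupling
delivers instead `∀ U ∈ window, ∃ c_U > 0, ∃ L₀(U), ∀ L ≥ L₀(U)`.  This file records the folklore
Baire-category step (Osgood's uniform-boundedness argument) that closes most of that gap:

* `exists_isOpen_uniform_eventual_floor` — abstract form.  `X` a Baire space, `W ⊆ X` open and
  non-empty, `F n : X → ℝ` continuous OFF a closed exceptional set `C n` (`n : ℕ`).  If every `x ∈ W`
  has an eventual floor `c_x > 0` (`c_x ≤ F n x` for `n ≥ N_x`, `x ∉ C n`), then some non-empty open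
  `V ⊆ W` carries a UNIFORM eventual floor: one `c > 0` and one `N` with `c ≤ F n x` for all `n ≥ N`,
  `x ∈ V ∖ C n`.  (The sets `A_{k,m} = ⋂_{n ≥ m} (C n ∪ {F n ≥ 1/(k+1)})` are closed and, with `Wᶜ`,
  cover `X`; by Baire one of them has interior meeting `W`.)
* `exists_Ioo_uniform_eventual_floor` — the same on the real line: the open set is a sub-interval
  `(U₁', U₂') ⊆ (U₁, U₂)`, and a parity (or any) side condition `Q n` on the index is carried along.
* `birWindowFloor_of_pointwise_offCrossings` — the crux's own objects: if, on a window of couplings,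
  the ground-state AVERAGE `d_{x²-y²}` pair intensity of `hubbardTorus 2 L 1 U` in the sector
  `(2⌊(1-δ)L²/2⌋, S^z = 0)` has a per-coupling floor `c_U · L⁴` eventually in even `L`, and for each
  even `L` the ground-eigenspace projection `U ↦ P_{U,L}` is continuous off a closed set `C L` of
  couplings (for the affine family `T + U·V` on a finite-dimensional sector this holds with `C L` the
  FINITE set of ground-level crossings — Rellich/Kato; that input is NOT proved here and enters as a
  hypothesis), then on a sub-window ONE constant serves every coupling `U ∉ C L`, in exactly the
  crux's basis-free form `c · L⁴ · Re tr P ≤ Re tr (P Δ_d† Δ_d)`.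
* `birWindowFloor_of_forall_hasDWavePairFieldLROAt` — the cross-route bridge modulo the exceptional
  couplings: the summit's matrix `HasDWavePairFieldLROAt U δ` at EVERY `U` of a window (the per-coupling
  output a `WeakCouplingBCS`-type route aims at) plus the same continuity input give the crux's inner
  inequality with one constant on a sub-window, off the sets `C L`
  (`forall_hasLRO_iff_groundState_bound` + `mul_re_trace_projMatrix_map_le` + the previous item).

What is deliberately NOT here: nothing about the Hubbard model is proved (no floor, no continuity);
the statements are closed implications.  The residual difference to the crux as typed is the bound AT
the exceptional couplings `U ∈ C L` (level crossings, where the ground eigenspace is a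
dimension-weighted mixture of analytic branches); the route's crux 5 (`BirEveryGroundState`,
average → every) selects a generic coupling and never consumes those points.

Sources: W. F. Osgood, "Non-uniform convergence and the integration of series term by term",
Amer. J. Math. 19 (1897) 155–190 (the uniform-boundedness-on-a-subinterval principle); R. Baire
(1899); T. Kato, Perturbation Theory for Linear Operators (1966), Ch. II §6 (analytic eigenprojections
of Hermitian affine families — cited for context only).  Folklore; no definition is introduced.
-/

noncomputable section

namespace Summit.HubbardSuperconductivity.HubbardSuperconductivity.Theorems.BirGroundStateAverageLRO.Uniformisation

open Set Filter Topology

section Abstract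

variable {X : Type*} [TopologicalSpace X]

/-- The closed "good set" at level `n` with threshold `a`: the points that are exceptional at level
`n` or carry the floor `a ≤ F n x`.  It is closed because its complement
`(C n)ᶜ ∩ (F n)⁻¹' (-∞, a)` is open (`F n` is continuous on the open set `(C n)ᶜ`). [folklore] -/
theorem isClosed_setOf_not_mem_imp_le (F : X → ℝ) (C : Set X) (hC : IsClosed C)
    (hF : ContinuousOn F Cᶜ) (a : ℝ) : IsClosed {x | x ∉ C → a ≤ F x} := by
  rw [← isOpen_compl_iff]
  have h : {x | x ∉ C → a ≤ F x}ᶜ = Cᶜ ∩ F ⁻¹' Set.Iio a := by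
    ext x
    simp only [mem_compl_iff, mem_setOf_eq, Classical.not_imp, not_le, mem_inter_iff, mem_preimage,
      mem_Iio]
  rw [h]
  exact hF.isOpen_inter_preimage hC.isOpen_compl isOpen_Iio

/-- **Baire uniformisation of eventual floors (Osgood's principle).** Let `X` be a Baire space,
`W ⊆ X` open and non-empty, `Q` any side condition on the index, and for each `n : ℕ` let
`F n : X → ℝ` be continuous off a closed exceptional set `C n` (for the indices with `Q n`).  If every
point `x ∈ W` has an
eventual positive floor off the exceptional sets — `∃ c > 0, ∃ N, ∀ n ≥ N, Q n → x ∉ C n → c ≤ F n x` —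
then there are a non-empty open `V ⊆ W`, ONE constant `c > 0` and ONE threshold `N` with
`c ≤ F n x` for all `n ≥ N` with `Q n` and all `x ∈ V`, `x ∉ C n`.  Proof: the sets
`A_{k,m} = {x | ∀ n ≥ m, Q n → x ∉ C n → 1/(k+1) ≤ F n x}` are closed, and together with `Wᶜ` they
cover `X`; by the Baire category theorem the union of their interiors is dense, so one
`interior A_{k,m}` meets `W`. [folklore] -/
theorem exists_isOpen_uniform_eventual_floor [BaireSpace X] {W : Set X} (hW : IsOpen W)
    (hWne : W.Nonempty) (Q : ℕ → Prop) (F : ℕ → X → ℝ) (C : ℕ → Set X)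
    (hC : ∀ n, IsClosed (C n)) (hF : ∀ n, Q n → ContinuousOn (F n) (C n)ᶜ)
    (h : ∀ x ∈ W, ∃ c : ℝ, 0 < c ∧ ∃ N : ℕ, ∀ n, N ≤ n → Q n → x ∉ C n → c ≤ F n x) :
    ∃ V : Set X, IsOpen V ∧ V.Nonempty ∧ V ⊆ W ∧ ∃ c : ℝ, 0 < c ∧ ∃ N : ℕ,
      ∀ n, N ≤ n → Q n → ∀ x ∈ V, x ∉ C n → c ≤ F n x := by
  classical
  -- the closed sets of the Baire argument
  let A : ℕ × ℕ → Set X := fun km =>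
    {x | ∀ n, km.2 ≤ n → Q n → x ∉ C n → (1 : ℝ) / ((km.1 : ℝ) + 1) ≤ F n x}
  have hA : ∀ km, IsClosed (A km) := by
    intro km
    have hrepr : A km = ⋂ n, {x | km.2 ≤ n → Q n → x ∉ C n → (1 : ℝ) / ((km.1 : ℝ) + 1) ≤ F n x} := by
      ext x
      simp only [A, mem_setOf_eq, mem_iInter]
    rw [hrepr]
    refine isClosed_iInter fun n => ?_
    by_cases hn : km.2 ≤ n
    · by_cases hq : Q n
      · have := isClosed_setOf_not_mem_imp_le (F n) (C n) (hC n) (hF n hq)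
          ((1 : ℝ) / ((km.1 : ℝ) + 1))
        convert this using 2 with x
        simp [hn, hq]
      · convert isClosed_univ
        ext x
        simp [hq]
    · convert isClosed_univ
      ext x
      simp [hn]
  -- the countable closed cover of `X`
  let f : Option (ℕ × ℕ) → Set X := fun o => Option.elim o Wᶜ A
  have hf : ∀ o, IsClosed (f o) := by
    rintro (_ | km)
    · exact hW.isClosed_compl
    · exact hA km
  have hcover : ⋃ o, f o = univ := by
    refine eq_univ_of_forall fun x => ?_
    by_cases hx : x ∈ W
    · obtain ⟨c, hc, N, hN⟩ := h x hx
      obtain ⟨k, hk⟩ := exists_nat_one_div_lt hc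
      refine mem_iUnion.mpr ⟨some (k, N), ?_⟩
      change x ∈ A (k, N)
      intro n hn hq hxC
      exact le_trans hk.le (hN n hn hq hxC)
    · exact mem_iUnion.mpr ⟨none, hx⟩
  have hdense : Dense (⋃ o, interior (f o)) := dense_iUnion_interior_of_closed hf hcover
  obtain ⟨x, hxU, hxW⟩ := hdense.exists_mem_open hW hWne
  obtain ⟨o, hxo⟩ := mem_iUnion.mp hxU
  rcases o with _ | ⟨k, m⟩
  · exact absurd hxW (interior_subset hxo)
  · refine ⟨interior (A (k, m)) ∩ W, isOpen_interior.inter hW, ⟨x, hxo, hxW⟩,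
      inter_subset_right, (1 : ℝ) / ((k : ℝ) + 1), Nat.one_div_pos_of_nat, m, ?_⟩
    intro n hn hq y hy hyC
    exact (interior_subset hy.1 : y ∈ A (k, m)) n hn hq hyC

end Abstract

section RealLine

/-- **Baire uniformisation on an interval of couplings.** Real-line form of
`exists_isOpen_uniform_eventual_floor`: if every `U` of an open interval `(U₁, U₂)` has an eventual
positive floor `c_U ≤ F n U` (`n ≥ N_U`, `Q n`, `U ∉ C n`), each `F n` with `Q n` being continuous off
the closed set `C n`, then on some sub-interval `(U₁', U₂') ⊆ (U₁, U₂)` one constant and one threshold serve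
every `U ∉ C n`. [folklore] -/
theorem exists_Ioo_uniform_eventual_floor {U₁ U₂ : ℝ} (hU : U₁ < U₂)
    (Q : ℕ → Prop) (F : ℕ → ℝ → ℝ) (C : ℕ → Set ℝ) (hC : ∀ n, IsClosed (C n))
    (hF : ∀ n, Q n → ContinuousOn (F n) (C n)ᶜ)
    (h : ∀ U ∈ Set.Ioo U₁ U₂, ∃ c : ℝ, 0 < c ∧ ∃ N : ℕ, ∀ n, N ≤ n → Q n → U ∉ C n → c ≤ F n U) :
    ∃ U₁' U₂' c : ℝ, U₁ ≤ U₁' ∧ U₁' < U₂' ∧ U₂' ≤ U₂ ∧ 0 < c ∧ ∃ N : ℕ,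
      ∀ n, N ≤ n → Q n → ∀ U ∈ Set.Ioo U₁' U₂', U ∉ C n → c ≤ F n U := by
  obtain ⟨V, hV, ⟨x, hxV⟩, hVW, c, hc, N, hN⟩ :=
    exists_isOpen_uniform_eventual_floor isOpen_Ioo (nonempty_Ioo.mpr hU) Q F C hC hF h
  obtain ⟨ε, hε, hball⟩ := Metric.isOpen_iff.mp hV x hxV
  have hxW : x ∈ Set.Ioo U₁ U₂ := hVW hxV
  have hx1 : U₁ < x := hxW.1
  have hx2 : x < U₂ := hxW.2
  refine ⟨max U₁ (x - ε), min U₂ (x + ε), c, le_max_left _ _, ?_, min_le_left _ _, hc, N, ?_⟩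
  · exact max_lt (lt_min hU (by linarith)) (lt_min (by linarith) (by linarith))
  · intro n hn hq U hU' hUC
    refine hN n hn hq U (hball ?_) hUC
    rw [Real.ball_eq_Ioo]
    exact ⟨lt_of_le_of_lt (le_max_right _ _) hU'.1, lt_of_lt_of_le hU'.2 (min_le_right _ _)⟩

end RealLine

section Hubbard

open Matrix Literature.MathematicalPhysics.QuantumLattice Literature.Probability.LatticeModels
open Summit.HubbardSuperconductivity.HubbardSuperconductivity.Theorems

/-- Continuity of the normalised trace ratio `U ↦ Re tr (P_U A) / (w · Re tr P_U)` on a set where the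
matrix-valued map `U ↦ P_U` is continuous and `Re tr P_U ≠ 0`, `w ≠ 0`. [folklore] -/
theorem continuousOn_re_trace_mul_div {n : Type*} [Fintype n] [DecidableEq n]
    {P : ℝ → Matrix n n ℂ} {s : Set ℝ} (hP : ContinuousOn P s) (A : Matrix n n ℂ) {w : ℝ}
    (hw : w ≠ 0) (htr : ∀ U ∈ s, (P U).trace.re ≠ 0) :
    ContinuousOn (fun U => (P U * A).trace.re / (w * (P U).trace.re)) s := by
  have hnum : Continuous fun M : Matrix n n ℂ => (M * A).trace.re :=
    Complex.continuous_re.comp ((continuous_id.matrix_mul continuous_const).matrix_trace)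
  have hden : Continuous fun M : Matrix n n ℂ => w * M.trace.re :=
    continuous_const.mul (Complex.continuous_re.comp continuous_id.matrix_trace)
  exact (hnum.comp_continuousOn hP).div (hden.comp_continuousOn hP)
    fun U hU => mul_ne_zero hw (htr U hU)

/-- **Window uniformisation for the crux's objects (off the exceptional couplings).** Fix `δ ≥ -1`
and an open window `(U₁, U₂)`.  For each side `L` let `P_{U,L}` be the projection onto the ground
eigenspace of `hubbardTorus 2 L 1 U` in the sector `(2⌊(1-δ)L²/2⌋, S^z = 0)` (transported to
`EuclideanSpace` by `Fock.toEuclidean`, exactly as in `BirGroundStateAverageLRO`) and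
`Δ_d = pairField dWaveFormFactor L`.  ASSUME (i) for every even `L ≥ 1`, `U ↦ P_{U,L}` is continuous
off a closed set `C L` of couplings (Rellich–Kato: true with `C L` the finite set of ground-level
crossings of the affine family `T + U·V` on the sector — NOT proved here), and (ii) every coupling `U`
of the window has its own floor: `∃ c_U > 0, ∃ L₀, ∀ even L ≥ L₀, U ∉ C L →
c_U · L⁴ · Re tr P_{U,L} ≤ Re tr (P_{U,L} Δ_d† Δ_d)`.  THEN on some sub-window `(U₁', U₂') ⊆ (U₁, U₂)`
ONE constant `c > 0` and one threshold `L₀` serve every coupling off the exceptional sets: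
`∀ even L ≥ L₀, ∀ U ∈ (U₁', U₂') ∖ C L, c · L⁴ · Re tr P_{U,L} ≤ Re tr (P_{U,L} Δ_d† Δ_d)` — the inner
inequality of `BirGroundStateAverageLRO`, verbatim.  Proof: `exists_Ioo_uniform_eventual_floor`
applied to the ratio `Re tr (P Δ_d†Δ_d) / (L⁴ Re tr P)` (`Re tr P ≥ 1`,
`one_le_re_trace_groundProj_hubbardTorus`). [folklore] -/
theorem birWindowFloor_of_pointwise_offCrossings (δ U₁ U₂ : ℝ) (hδ : -1 ≤ δ) (hU : U₁ < U₂)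
    (C : ℕ → Set ℝ) (hC : ∀ L, IsClosed (C L))
    (hP : ∀ (L : ℕ) [NeZero L], Even L → ContinuousOn (fun U : ℝ =>
      let N : ℕ := 2 * ⌊(1 - δ) * (L : ℝ) ^ 2 / 2⌋₊;
      let H := hubbardTorus 2 L 1 U;
      let S := szSector (Λ := FermionTorus 2 L) N 0;
      let E₀ := S ⊓ Module.End.eigenspace (Matrix.toLin' H) ((H.minEnergyOn S : ℝ) : ℂ);
      projMatrix (E₀.map (Fock.toEuclidean (ι := Orb (FermionTorus 2 L)) :
        Fock (Orb (FermionTorus 2 L)) →ₗ[ℂ] EuclideanSpace ℂ (Finset (Orb (FermionTorus 2 L))))))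
      (C L)ᶜ)
    (h : ∀ U ∈ Set.Ioo U₁ U₂, ∃ c : ℝ, 0 < c ∧ ∃ L₀ : ℕ, ∀ (L : ℕ) [NeZero L], L₀ ≤ L → Even L →
      U ∉ C L →
        let N : ℕ := 2 * ⌊(1 - δ) * (L : ℝ) ^ 2 / 2⌋₊;
        let H := hubbardTorus 2 L 1 U;
        let S := szSector (Λ := FermionTorus 2 L) N 0;
        let E₀ := S ⊓ Module.End.eigenspace (Matrix.toLin' H) ((H.minEnergyOn S : ℝ) : ℂ);
        let P := projMatrix (E₀.map (Fock.toEuclidean (ι := Orb (FermionTorus 2 L)) :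
          Fock (Orb (FermionTorus 2 L)) →ₗ[ℂ] EuclideanSpace ℂ (Finset (Orb (FermionTorus 2 L)))));
        c * (L : ℝ) ^ 4 * P.trace.re ≤
          (P * ((pairField dWaveFormFactor L)ᴴ * pairField dWaveFormFactor L)).trace.re) :
    ∃ U₁' U₂' c : ℝ, U₁ ≤ U₁' ∧ U₁' < U₂' ∧ U₂' ≤ U₂ ∧ 0 < c ∧ ∃ L₀ : ℕ, ∀ (L : ℕ) [NeZero L],
      L₀ ≤ L → Even L → ∀ U ∈ Set.Ioo U₁' U₂', U ∉ C L →
        let N : ℕ := 2 * ⌊(1 - δ) * (L : ℝ) ^ 2 / 2⌋₊;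
        let H := hubbardTorus 2 L 1 U;
        let S := szSector (Λ := FermionTorus 2 L) N 0;
        let E₀ := S ⊓ Module.End.eigenspace (Matrix.toLin' H) ((H.minEnergyOn S : ℝ) : ℂ);
        let P := projMatrix (E₀.map (Fock.toEuclidean (ι := Orb (FermionTorus 2 L)) :
          Fock (Orb (FermionTorus 2 L)) →ₗ[ℂ] EuclideanSpace ℂ (Finset (Orb (FermionTorus 2 L)))));
        c * (L : ℝ) ^ 4 * P.trace.re ≤
          (P * ((pairField dWaveFormFactor L)ᴴ * pairField dWaveFormFactor L)).trace.re := by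
  classical
  -- the ground-eigenspace projection and the normalised intensity, as honest functions of `(L, U)`
  let Pr : ∀ (L : ℕ) [NeZero L], ℝ →
      Matrix (Finset (Orb (FermionTorus 2 L))) (Finset (Orb (FermionTorus 2 L))) ℂ :=
    fun L _ U =>
      let N : ℕ := 2 * ⌊(1 - δ) * (L : ℝ) ^ 2 / 2⌋₊;
      let H := hubbardTorus 2 L 1 U;
      let S := szSector (Λ := FermionTorus 2 L) N 0;
      let E₀ := S ⊓ Module.End.eigenspace (Matrix.toLin' H) ((H.minEnergyOn S : ℝ) : ℂ);
      projMatrix (E₀.map (Fock.toEuclidean (ι := Orb (FermionTorus 2 L)) :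
        Fock (Orb (FermionTorus 2 L)) →ₗ[ℂ] EuclideanSpace ℂ (Finset (Orb (FermionTorus 2 L)))))
  let G : ∀ (L : ℕ) [NeZero L], ℝ → ℝ := fun L _ U =>
    (Pr L U * ((pairField dWaveFormFactor L)ᴴ * pairField dWaveFormFactor L)).trace.re /
      ((L : ℝ) ^ 4 * (Pr L U).trace.re)
  let F : ℕ → ℝ → ℝ := fun L U => if hL : L = 0 then 0 else @G L ⟨hL⟩ U
  -- `Re tr P ≥ 1`, so the weight `L⁴ · Re tr P` is positive
  have htr : ∀ (L : ℕ) [NeZero L] (U : ℝ), 1 ≤ (Pr L U).trace.re := fun L _ U =>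
    one_le_re_trace_groundProj_hubbardTorus L 1 U δ hδ
  have hw : ∀ (L : ℕ) [NeZero L], (0 : ℝ) < (L : ℝ) ^ 4 := fun L _ => by
    have : (0 : ℝ) < (L : ℝ) := Nat.cast_pos.mpr (Nat.pos_of_ne_zero (NeZero.ne L))
    positivity
  -- the floor `c ≤ F L U` IS the crux's inner inequality at `(L, U)`
  have key : ∀ (L : ℕ) [NeZero L] (U c : ℝ), c ≤ F L U ↔
      c * (L : ℝ) ^ 4 * (Pr L U).trace.re ≤
        (Pr L U * ((pairField dWaveFormFactor L)ᴴ * pairField dWaveFormFactor L)).trace.re := by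
    intro L _ U c
    have hF : F L U = G L U := by simp only [F, dif_neg (NeZero.ne L)]
    rw [hF]
    change c ≤ _ / _ ↔ _
    rw [le_div_iff₀ (mul_pos (hw L) (lt_of_lt_of_le one_pos (htr L U))), mul_assoc]
  -- continuity of `F L` off `C L` for even `L ≥ 1`
  have hFcont : ∀ L, (Even L ∧ L ≠ 0) → ContinuousOn (F L) (C L)ᶜ := by
    rintro L ⟨hLe, hL0⟩
    haveI : NeZero L := ⟨hL0⟩
    have hF : F L = G L := by
      funext U
      simp only [F, dif_neg hL0]
    rw [hF]
    exact continuousOn_re_trace_mul_div (hP L hLe) _ (hw L).ne'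
      fun U _ => (lt_of_lt_of_le one_pos (htr L U)).ne'
  -- Baire
  obtain ⟨U₁', U₂', c, h₁, h₁₂, h₂, hc, N, hN⟩ :=
    exists_Ioo_uniform_eventual_floor hU (fun L => Even L ∧ L ≠ 0) F C hC hFcont (by
      intro U hUW
      obtain ⟨c, hc, L₀, hL₀⟩ := h U hUW
      refine ⟨c, hc, L₀, fun L hL hq hUC => ?_⟩
      haveI : NeZero L := ⟨hq.2⟩
      exact (key L U c).mpr (hL₀ L hL hq.1 hUC))
  refine ⟨U₁', U₂', c, h₁, h₁₂, h₂, hc, N, fun L _ hL hLe U hU' hUC => ?_⟩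
  exact (key L U c).mp (hN L hL ⟨hLe, NeZero.ne L⟩ U hU' hUC)

/-- **Cross-route bridge, modulo the exceptional couplings.** If at EVERY coupling `U` of an open
window `(U₁, U₂)` the summit's matrix `HasDWavePairFieldLROAt U δ` holds (every sequence of normalised
`(2⌊(1-δ)L²/2⌋, S^z = 0)`-sector ground states of `hubbardTorus 2 L 1 U` has `d_{x²-y²}` pair-field
long-range order along even sides — the per-coupling output a `WeakCouplingBCS`-type route aims at), and
for every even `L ≥ 1` the ground-eigenspace projection `U ↦ P_{U,L}` is continuous off a closed set
`C L` of couplings (Rellich–Kato input, hypothesis), then on some sub-window `(U₁', U₂') ⊆ (U₁, U₂)`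
the inner inequality of `BirGroundStateAverageLRO` holds with ONE constant: `∃ c > 0, ∃ L₀, ∀ even
L ≥ L₀, ∀ U ∈ (U₁', U₂') ∖ C L, c · L⁴ · Re tr P_{U,L} ≤ Re tr (P_{U,L} Δ_d† Δ_d)`.  Proof: per
coupling, `forall_hasLRO_iff_groundState_bound` turns the matrix into an every-ground-state floor
`c_U L⁴`, `mul_re_trace_projMatrix_map_le` into the trace floor, and
`birWindowFloor_of_pointwise_offCrossings` uniformises.  What separates this from the crux as typed
is exactly the set of exceptional couplings `C L` and the positivity `0 < U₁'` (take `0 ≤ U₁`).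
[folklore] -/
theorem birWindowFloor_of_forall_hasDWavePairFieldLROAt (δ U₁ U₂ : ℝ) (hδ : -1 ≤ δ) (hU : U₁ < U₂)
    (C : ℕ → Set ℝ) (hC : ∀ L, IsClosed (C L))
    (hP : ∀ (L : ℕ) [NeZero L], Even L → ContinuousOn (fun U : ℝ =>
      let N : ℕ := 2 * ⌊(1 - δ) * (L : ℝ) ^ 2 / 2⌋₊;
      let H := hubbardTorus 2 L 1 U;
      let S := szSector (Λ := FermionTorus 2 L) N 0;
      let E₀ := S ⊓ Module.End.eigenspace (Matrix.toLin' H) ((H.minEnergyOn S : ℝ) : ℂ);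
      projMatrix (E₀.map (Fock.toEuclidean (ι := Orb (FermionTorus 2 L)) :
        Fock (Orb (FermionTorus 2 L)) →ₗ[ℂ] EuclideanSpace ℂ (Finset (Orb (FermionTorus 2 L))))))
      (C L)ᶜ)
    (h : ∀ U ∈ Set.Ioo U₁ U₂, Literature.Barriers.HubbardSuperconductivity.HasDWavePairFieldLROAt U δ) :
    ∃ U₁' U₂' c : ℝ, U₁ ≤ U₁' ∧ U₁' < U₂' ∧ U₂' ≤ U₂ ∧ 0 < c ∧ ∃ L₀ : ℕ, ∀ (L : ℕ) [NeZero L],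
      L₀ ≤ L → Even L → ∀ U ∈ Set.Ioo U₁' U₂', U ∉ C L →
        let N : ℕ := 2 * ⌊(1 - δ) * (L : ℝ) ^ 2 / 2⌋₊;
        let H := hubbardTorus 2 L 1 U;
        let S := szSector (Λ := FermionTorus 2 L) N 0;
        let E₀ := S ⊓ Module.End.eigenspace (Matrix.toLin' H) ((H.minEnergyOn S : ℝ) : ℂ);
        let P := projMatrix (E₀.map (Fock.toEuclidean (ι := Orb (FermionTorus 2 L)) :
          Fock (Orb (FermionTorus 2 L)) →ₗ[ℂ] EuclideanSpace ℂ (Finset (Orb (FermionTorus 2 L)))));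
        c * (L : ℝ) ^ 4 * P.trace.re ≤
          (P * ((pairField dWaveFormFactor L)ᴴ * pairField dWaveFormFactor L)).trace.re := by
  refine birWindowFloor_of_pointwise_offCrossings δ U₁ U₂ hδ hU C hC hP fun U hUW => ?_
  obtain ⟨c, hc, L₀, hL₀⟩ := (forall_hasLRO_iff_groundState_bound U δ hδ).mp (h U hUW)
  refine ⟨c, hc, L₀, fun L _ hL hLe _ => ?_⟩
  intro N H S E₀ P
  exact mul_re_trace_projMatrix_map_le E₀ _ (c * (L : ℝ) ^ 4) fun ψ hψ hunit =>
    hL₀ L hL hLe ψ (isGroundStateInSector_of_mem_inf_eigenspace H N 0 hψ hunit) hunit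

end Hubbard

end Summit.HubbardSuperconductivity.HubbardSuperconductivity.Theorems.BirGroundStateAverageLRO.Uniformisation
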